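import Summits.QuantumFields.YangMills.Theorems.LangevinControlUVOSLegsAtWeakCouplingCSketchSplit
import Summits.QuantumFields.YangMills.Theorems.LangevinControlUVOSLegsFromFemtoAndGapStubCollar6
import Summits.QuantumFields.YangMills.Theorems.LangevinControlUVOSLegsAtWeakCouplingCFblOfFbl6
import Summits.QuantumFields.YangMills.Theorems.LangevinControlUVOSLegsAtWeakCouplingCInheritedAmplitudeGatesDefs
import Summits.QuantumFields.YangMills.Theorems.LangevinControlUVOSLegsAtWeakCouplingCStubLowerI
import Summits.QuantumFields.YangMills.Theorems.LangevinControlUVOSLegsAtWeakCouplingCStubInherit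
import HarnessLib

/-!
# Crux `OSLegsAtWeakCouplingC` (stmt-QuantumFields-16207), line `inherited-amplitude-gates`: planner skeleton (v1, crux-plan)

Card `Cruxes/OSLegsAtWeakCouplingC/Ideas/inherited-amplitude-gates.md` (ideator 1, triage r1-1/r1-2: pass, pass) turned into a
CLOSING skeleton.  The crux (H1 femto two-point package ∧ H2 femto skewness ∧ H3 gap in continuous units ⟹ weak-coupling
scheme + non-trivial, non-Gaussian OS data with a lattice gap) is, by the LANDED predicate-form glue
`Sketch.osLegsAtWeakCouplingC_of_legs` (…SketchSplit, p140922), the conjunction of three legs E0′ (`MomentBounds6`), NT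
(`LowerBounds`) and lattice-E1; NT and lattice-E1 are NECESSARY (p138920 / p139098), so every line carries them.  THIS line
re-types the INPUT of the two legs E0′ and NT as femto-CUBE statements of the kind a background-field / frozen-link engine
outputs, and makes H1 load-bearing (Disproof §2 `cruxC_false_without_twoPoint`): the ABSOLUTE two-sided amplitude of the
conditional two-point function of the action density, for EVERY exterior, is INHERITED from the periodic femto torus —

  law of total covariance on a femto torus `T ⊇ cube B`:  `Cov_T(P_x, P_y) = E_T[kerCov_η(P_x, P_y)] + Cov_T(kerE_η P_x, kerE_η P_y)`,
  H1 pins the left side two-sidedly at the `(0,1)`-plane / `e₂`-axis pairs, `FBL6` sup-bounds the second term and the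
  gate budget `M`, the η-RELATIVE gates `GateAxis`/`GateD` (`|K(η) − K(1)| ≤ C (M √K(1) + M² + |K(1)| κ⁻²)`, flat exterior
  `η = 1`) are SOLVED for the flat-box value `K(1)` and PROPAGATED to every exterior, and the flat-box shape fact
  `FlatShape2` passes from the pinned axis pair to the density in every direction (`stub_inherit`, provable now) —

so the engine owes only η-RELATIVE gates, the one-point boundary law `FBL6`, flat-box shape facts, the open-window fit
`FitWindow` on H1's own witnesses, and (NOT inherited: the density's `κ₃` is a duality zero at tree level) the absolute
signed conditional cumulant `FC3`.  Stubs (7; sorries ONLY here):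

* `stub_boundaryLaw`  : hyps ⟹ `FBL6`                                        — ENGINE (one-point, sup over exteriors; E0′ then by the landed `stub_collar6`);
* `stub_gates`        : hyps ⟹ `GateAxis ∧ GateD`                            — ENGINE, η-relative, all exteriors (the line's bet);
* `stub_tame`         : hyps ⟹ `FlatShape2 ∧ FitWindow`                      — ENGINE on ONE tame measure each (flat box shape; fixed femto
  torus fit `n⁸Cov ≥ K (n a)⁸` on a swept β-window);
* `stub_inherit`      : `Continuous a → H1 → FitWindow → FBL6 → GateAxis → GateD → FlatShape2 → FC2I` — LANDED (lead a1, …StubInherit + 4 helpers);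
* `stub_skewFloor`    : hyps ⟹ `FC3`                                         — ENGINE (absolute signed conditional `κ₃`, two-loop precision);
* `stub_lowerI`       : `a > 0 → a → 0 → FBL → FC2I → FC3 → LowerBounds`     — LANDED (p164159, …StubLowerI + TwoPoint/ThreePoint);
* `stub_latticeWardGerm` : E1C VERBATIM (the registered stub of line `Sketch`, = candidate item `LatticeWardGermC`) — ENGINE, NECESSARY.

`OSLegsAtWeakCouplingC_of` composes them through `osLegsAtWeakCouplingC_of_legs` (E0′ ⇐ `stub_collar6 ∘ stub_boundaryLaw`;
NT ⇐ `stub_lowerI` fed by `fbl_of_fbl6`, `stub_inherit` (H1 + `stub_tame` + `stub_boundaryLaw` + `stub_gates`), `stub_skewFloor`; E1 ⇐ `latticeWard_of_latticeWardGermC_pointwise ∘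
stub_latticeWardGerm`) and concludes the route decl BY NAME.  Vocabulary: the landed Defs of line `dlr-collar-transfer`
(`TwoPoint`, `Skewness`, `GapInUnits`, `kerE`, `kerCov`, `depth`, `plane`, `dens`, `FBL`, `FBL6`, `FC3`, `LowerBounds`,
`MomentBounds6`); the four new predicates `GateAxis`, `GateD`, `FlatShape2`, `FitWindow` and the interface `FC2I` are defined
below (nothing asserted).  Disproof v2 honoured: §2 (H1 used essentially: it pins `K(1)` in `stub_inherit`), §3/§5 (all effort
on the non-vacuum content; the extra input is NAMED: gates + FBL6 + flat shape + fit + FC3), §6 (`Continuous a`: interval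
pinning landed, bounds stated on windows), §7 (scheme chosen, nothing ∀-scheme); `-- Targets: none`; no stub is an instance of
a landed `Negative/*` lemma (FalseWithoutTwoPoint, WeakCouplingConjunct, GermAtInfinity concern the crux minus H1 / the vacuum
scheme / germs of `a`, none of which any stub asserts).  Line card `Lines/inherited-amplitude-gates.md`.
-/

set_option autoImplicit false

noncomputable section

open scoped SchwartzMap BigOperators
open MeasureTheory Filter Topology
open Literature.MathematicalPhysics.QuantumFieldTheory Literature.MathematicalPhysics.QuantumLattice
open Literature.MathematicalPhysics.AQFT Literature.Probability.LatticeModels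
open Summit.QuantumFields.YangMills.Theses.LangevinControlUV (OSLegsAtWeakCouplingC)
open Summit.QuantumFields.YangMills.Cruxes.OSLegsFromFemtoAndGap.DlrCollarTransfer
open Summit.QuantumFields.YangMills.Cruxes.OSLegsAtWeakCouplingC.Sketch
  (osLegsAtWeakCouplingC_of_legs uvHyperscalingC_pointwise_iff latticeWard_of_latticeWardGermC_pointwise)

namespace Summit.QuantumFields.YangMills.Cruxes.OSLegsAtWeakCouplingC.InheritedAmplitudeGates

/-! ## §1 Vocabulary of the line

The five route-posited predicates `GateAxis`, `GateD`, `FlatShape2`, `FitWindow`, `FC2I` are LANDED verbatim (same namespace) in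
`Theorems/LangevinControlUVOSLegsAtWeakCouplingCInheritedAmplitudeGatesDefs.lean` (p162966) and imported above; nothing is declared here. -/


/-! ## §2 The registered stubs (the ONLY sorries of the file) -/

/-- **stub_boundaryLaw** [ENGINE-GRADE; E0′ follows by the landed `stub_collar6`]: for a compact simple `G`, a faithful `r`
and a continuous unit map carrying H1–H3, the plane-resolved femto boundary law `FBL6` — on every femto cube, for EVERY
exterior, the conditional mean of each single-plane plaquette field at depth `d ≥ 2` is within `C₁/d⁴` of a reference value
(a boundary forces `O(1)` flux, which spreads as curvature `O(d⁻²)`; compactness + non-abelianness of `G`; Dobrushin-type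
boundary-influence decay, Georgii2011 Ch. 8; Balaban1989LargeFieldII background fields; triager-2 funnel cascade kit j012977). -/
theorem stub_boundaryLaw :
    ∀ (G : Type) [Group G] [TopologicalSpace G] [IsTopologicalGroup G] [CompactSpace G]
      [MeasurableSpace G] [BorelSpace G], IsCompactSimpleLieGroup G →
      ∀ (r : LatticeRep G) (a : ℝ → ℝ), Continuous a → TwoPoint G r a → Skewness G r a → GapInUnits G r a →
        FBL6 G r a := by
  sorry

/-- **stub_gates** [ENGINE-GRADE, η-RELATIVE, ALL EXTERIORS — the line's bet and its distinctive stub]: for `(G, r, a)` as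
in the crux, the scale-free covariance gates relative to the FLAT exterior: `GateAxis` (the `(0,1)`/`e₂`-axis pairs H1
pins) and `GateD` (the action density, all directions).  Intended proof: the route's frozen-link Langevin / Boué–Dupuis
engine (the cube kernel `ymSpecification` is its invariant law on fewer coordinates) or a Bałaban background-field step, run
RELATIVE to the flat background: mean shift ↦ `M`, cross term ↦ `M √K(1)`, kernel change ↦ `|K(1)| κ⁻²`; landed
infrastructure: translation covariance / consistency of `ymSpecification` (`NonSimplyConnectedLatticeGap.integral_ymSpecification_shift`,
`stub_boxInfluence_inward`, route ConvexGribovBody).  Why it might fail / cheapest falsifier: the "leak scenario" — an exterior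
changing the fluctuation kernel between `x` and `y` at `O(1)` relative while every conditional mean on the collar stays within
a small `M` (classical `β = ∞` `SU(2)` minimisation on a `17⁴–25⁴` block, card §Cheapest falsifier (d)); it would force the
half-ball budget (means read on all of the depth-`(κ−2)n` region — already the form used here) or kill the multiplicative gate. -/
theorem stub_gates :
    ∀ (G : Type) [Group G] [TopologicalSpace G] [IsTopologicalGroup G] [CompactSpace G]
      [MeasurableSpace G] [BorelSpace G], IsCompactSimpleLieGroup G →
      ∀ (r : LatticeRep G) (a : ℝ → ℝ), Continuous a → TwoPoint G r a → Skewness G r a → GapInUnits G r a →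
        GateAxis G r a ∧ GateD G r a := by
  sorry

/-- **stub_tame** [ENGINE-GRADE but on ONE tame measure each — no sup over exteriors]: for `(G, r, a)` as in the crux,
(i) the flat-box shape comparison `FlatShape2` (flat frozen walls: unique flat minimum modulo interior gauge, transversal
Hessian = Dirichlet lattice Maxwell operator, no torons / constant modes — the lattice Schrödinger-functional setting of
LuscherEtAl1992 §2; tree level `12/|y−x|⁸ : 2/m⁸`, images `O(κ₇⁻²)`, loops `O(g²)`), and (ii) the open-window fit
`FitWindow` on H1's own witnesses (two-sided weak-coupling asymptotics of ONE axis-pair plaquette covariance on ONE fixed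
femto torus `L = 8n`, Laplace method around the flat connections, times any decay `a(β) = o(β^{-1/4})` of the unit map —
physically automatic under the gap in units `a` (H3) and asymptotic freedom, formally not supplied: why it might fail = a
unit map slower than `β^{-1/4}` meeting H1–H3, neither excluded nor refutable (Disproof §1); and (i) fails if the flat
density covariance changes sign in some direction / separation regime — lattice artefacts below `n₇`, wall images below `κ₇`). -/
theorem stub_tame :
    ∀ (G : Type) [Group G] [TopologicalSpace G] [IsTopologicalGroup G] [CompactSpace G]
      [MeasurableSpace G] [BorelSpace G], IsCompactSimpleLieGroup G →
      ∀ (r : LatticeRep G) (a : ℝ → ℝ), Continuous a → TwoPoint G r a → Skewness G r a → GapInUnits G r a →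
        FlatShape2 G r a ∧ FitWindow G r a := by
  sorry

-- `stub_inherit` LANDED (lead a1; Theorems/LangevinControlUVOSLegsAtWeakCouplingCStubInherit.lean + helper files …StubInheritTorus
-- p167418, …StubInheritAxis p168047, …StubInheritPair p168366, …StubInheritGeometry p168737): imported above under the same name
-- and signature (`Continuous a → TwoPoint → FitWindow → FBL6 → GateAxis → GateD → FlatShape2 → FC2I`).

/-- **stub_skewFloor** [ENGINE-GRADE, two-loop precision; NOT inherited]: for `(G, r, a)` as in the crux, the absolute signed
conditional third cumulant `FC3` of the action density at one reference shape, for every exterior (the predecessor line's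
third conjunct of `stub_fcp6`, unchanged).  The density's `κ₃` vanishes at tree level (duality zero `⋆R⋆ = −R`; ideator-1
Findings §6, k3tree.py), so this is sign control of the `O(g²)`-relative term uniformly over exteriors; H2 (single-plane
`(01)³`, tree level `g⁶`) does not feed it as typed — the hardest ENGINE stub of the line, shared with every `stub_fcp6`-type cut. -/
theorem stub_skewFloor :
    ∀ (G : Type) [Group G] [TopologicalSpace G] [IsTopologicalGroup G] [CompactSpace G]
      [MeasurableSpace G] [BorelSpace G], IsCompactSimpleLieGroup G →
      ∀ (r : LatticeRep G) (a : ℝ → ℝ), Continuous a → TwoPoint G r a → Skewness G r a → GapInUnits G r a →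
        FC3 G r a := by
  sorry

-- `stub_lowerI` LANDED (p164159, Theorems/LangevinControlUVOSLegsAtWeakCouplingCStubLowerI.lean; helpers …StubLowerITwoPoint p163864,
-- …StubLowerIThreePoint p163959): imported above under the same name and signature.

/-- **stub_latticeWardGerm** [IMPORT E1C = candidate item `LatticeWardGermC`; engine-grade, NECESSARY in lattice form
(p139098), barrier `RegularisationDichotomy`; VERBATIM the registered stub of line `Sketch` v10c so that the two lines share
the item]: for every `G`, `r`, continuous `a` carrying H1 and H3, and given E0′ at `(G, r, a)`: along every scheme in units
`a` with `β_k → ∞` and the bundle ranges there is `r₀ > 0` such that for `n ≥ 2` the centred lattice `n`-point distributions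
of the action density annihilate, as `k → ∞`, the `(x₀,x₁)`-rotation-generator derivative `D` of every compactly supported,
separated, off-diagonal test function `F` of diameter `< r₀`. -/
theorem stub_latticeWardGerm :
    open Literature.MathematicalPhysics.QuantumLattice Literature.MathematicalPhysics.AQFT Literature.MathematicalPhysics.QuantumFieldTheory Literature.Probability.LatticeModels in ∀ (G : Type) [Group G] [TopologicalSpace G] [IsTopologicalGroup G] [CompactSpace G], IsCompactSimpleLieGroup G → letI : MeasurableSpace G := borel G; haveI : BorelSpace G := ⟨rfl⟩; ∀ (r : LatticeRep G), ∀ (a : ℝ → ℝ), Continuous a → (∃ (Γ : ℝ → ℝ) (β₀ ℓ₀ c C : ℝ), 0 < ℓ₀ ∧ 0 < c ∧ (∀ β, 0 < a β) ∧ Filter.Tendsto a Filter.atTop (nhds 0) ∧ (∀ s : ℝ, 0 < s → s ≤ ℓ₀ → 0 < Γ s ∧ Γ s ≤ 1) ∧ ∀ (L : ℕ) [NeZero L] (β : ℝ), β₀ ≤ β → (L : ℝ) * a β ≤ ℓ₀ → let P : (Fin 4 → ZMod L) → Fin 4 → Fin 4 → GaugeConfig 4 L G → ℝ := fun x i j U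 => (r.N : ℝ) - (r.ρ (plaquetteHolonomy U x i j)).trace.re; let E : (GaugeConfig 4 L G → ℝ) → ℝ := fun F => wilsonExpectation (d := 4) (L := L) r.ρ β F; let cov : (GaugeConfig 4 L G → ℝ) → (GaugeConfig 4 L G → ℝ) → ℝ := fun F F' => E (fun U => F U * F' U) - E F * E F'; let dist : (Fin 4 → ZMod L) → (Fin 4 → ZMod L) → ℝ := fun x y => Real.sqrt (∑ k : Fin 4, (((x k - y k).valMinAbs : ℤ) : ℝ) ^ 2); (∀ n : ℕ, 1 ≤ n → 8 * n ≤ L → c * Γ ((n : ℝ) * a β) ≤ (n : ℝ) ^ 8 * cov (P 0 0 1) (P (Pi.single (2 : Fin 4) ((n : ℕ) : ZMod L)) 0 1) ∧ (n : ℝ) ^ 8 * cov (P 0 0 1) (P (Pi.single (2 : Fin 4) ((n : ℕ) : ZMod L)) 0 1) ≤ C * Γ ((n : ℝ) * a β)) ∧ (∀ (x y : Fin 4 → ZMod L) (i j i' j' : Fin 4), x ≠ y → i ≠ j → i' ≠ j' → |cov (P x i j) (P y i' j')| * dist x y ^ 8 ≤ C * Γ (dist x y * a β))) → (∃ (c₁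 β₂ : ℝ) (S₁ : ℝ → ℕ), 0 < c₁ ∧ ∀ A B : YMSpecies G, ∃ C : ℝ, ∀ β : ℝ, β₂ ≤ β → ∀ S n : ℕ, S₁ β ≤ S → n ≤ S → |latticeConnectedCorr r.ρ β (2 * S + 1) A.F B.F n| ≤ C * Real.exp (-(c₁ * a β * n))) → (∃ (C β₄ ℓ₄ : ℝ), 0 < ℓ₄ ∧ 0 ≤ C ∧ ∀ β : ℝ, β₄ ≤ β → ∀ (L n : ℕ) (q : Fin n → Fin 4 × Fin 4) (x : Fin n → (Fin 4 → ℤ)) (R : ℕ), (∀ i, (q i).1 < (q i).2) → 1 ≤ R → (R : ℝ) * a β ≤ ℓ₄ → 4 * R + 8 ≤ L → (∀ i j : Fin n, i ≠ j → ∃ k : Fin 4, (2 * (R : ℤ) + 4) ≤ |((((x i k - x j k : ℤ) : ZMod (2 * L + 1))).valMinAbs : ℤ)|) → let E : (LGConfig 4 G → ℝ) → ℝ := fun F => ∫ U, F (torusLift (2 * L + 1) U) ∂(wilsonMeasure (d := 4) (L := 2 * L + 1) r.ρ β); let Pl : Fin 4 × Fin 4 → (Fin 4 → ℤ) → LGConfig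 4 G → ℝ := fun p y U => plaquetteObs r.ρ 0 p.1 p.2 (configShift (-y) U); |E (fun U => ∏ i, (Pl (q i) (x i) U - E (Pl (q i) (x i))))| ≤ (C / (R : ℝ) ^ 4) ^ n) → ∀ (sch : SpeciesScheme (YMSpecies G)), (∀ k, sch.a k = a (sch.β k)) → Filter.Tendsto sch.β Filter.atTop Filter.atTop → (∀ k, 0 ≤ sch.β k ∧ sch.a k ≤ 1 / 24 ∧ 14 ≤ sch.L k ∧ (sch.a k)⁻¹ * (sch.a k)⁻¹ ≤ sch.L k) → ∃ r₀ : ℝ, 0 < r₀ ∧ ∀ (n : ℕ), 2 ≤ n → ∀ (F D : SchwartzMap (Fin n → EuclideanSpace ℝ (Fin 4)) ℂ), IsOffDiagonal F → HasCompactSupport (F : (Fin n → EuclideanSpace ℝ (Fin 4)) → ℂ) → (∃ δ : ℝ, 0 < δ ∧ tsupport (F : (Fin n → EuclideanSpace ℝ (Fin 4)) → ℂ) ⊆ {x | ∀ i j, i ≠ j → δ ≤ dist (x i) (x j)}) → tsupport (F : (Fin n → EuclideanSpace ℝ (Fin 4)) → ℂ) ⊆ {x | ∀ i j, dist (x i)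 (x j) < r₀} → (∀ x, D x = fderiv ℝ (F : (Fin n → EuclideanSpace ℝ (Fin 4)) → ℂ) x (fun k => (x k 0) • (EuclideanSpace.single 1 1 : EuclideanSpace ℝ (Fin 4)) - (x k 1) • (EuclideanSpace.single 0 1 : EuclideanSpace ℝ (Fin 4)))) → Filter.Tendsto (fun k : ℕ => ∑ x ∈ Fintype.piFinset (fun _ : Fin n => box 4 (sch.L k)), (((∫ U, ∏ i, (r.curvature.F (configShift (-(x i)) (torusLift (2 * sch.L k + 1) U)) - ∫ V, r.curvature.F (torusLift (2 * sch.L k + 1) V) ∂(wilsonMeasure (d := 4) (L := 2 * sch.L k + 1) r.ρ (sch.β k))) ∂(wilsonMeasure (d := 4) (L := 2 * sch.L k + 1) r.ρ (sch.β k)) : ℝ) : ℂ) * D (fun i => sch.a k • siteToE (x i)))) Filter.atTop (nhds 0) := by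
  sorry


/-! ## §3 The composition: the crux BY NAME from the seven stubs (landed glue `osLegsAtWeakCouplingC_of_legs`, p140922) -/

/-- **The crux from the line's stubs.**  E0′ (`MomentBounds6`) from `stub_boundaryLaw` by the landed collar transfer
`stub_collar6`; NT (`LowerBounds`) from `stub_lowerI` fed by `fbl_of_fbl6 ∘ stub_boundaryLaw`, the INHERITED two-point
package `stub_inherit` (H1 + `stub_tame` + `stub_boundaryLaw` + `stub_gates`) and `stub_skewFloor`; lattice-E1 from
`stub_latticeWardGerm` through the landed bridge `latticeWard_of_latticeWardGermC_pointwise`; glued by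
`osLegsAtWeakCouplingC_of_legs`.  Sorry-free modulo the seven stubs. -/
theorem OSLegsAtWeakCouplingC_of : OSLegsAtWeakCouplingC := by
  refine osLegsAtWeakCouplingC_of_legs ?_ ?_ ?_
  · intro G _ _ _ _ hG
    letI : MeasurableSpace G := borel G
    haveI : BorelSpace G := ⟨rfl⟩
    intro r a ha h1 h2 h3
    exact stub_collar6 G r a (stub_boundaryLaw G hG r a ha h1 h2 h3)
  · intro G _ _ _ _ hG
    letI : MeasurableSpace G := borel G
    haveI : BorelSpace G := ⟨rfl⟩
    intro r a ha h1 h2 h3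
    have hFBL6 : FBL6 G r a := stub_boundaryLaw G hG r a ha h1 h2 h3
    obtain ⟨hGA, hGD⟩ := stub_gates G hG r a ha h1 h2 h3
    obtain ⟨hFS, hFit⟩ := stub_tame G hG r a ha h1 h2 h3
    have hFC2I : FC2I G r a := stub_inherit G hG r a ha h1 hFit hFBL6 hGA hGD hFS
    have hFC3 : FC3 G r a := stub_skewFloor G hG r a ha h1 h2 h3
    obtain ⟨Γ, β₀, ℓ₀, c, C, -, -, hpos, hlim, -⟩ := h1
    exact stub_lowerI G r a hpos hlim (fbl_of_fbl6 r a hFBL6) hFC2I hFC3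
  · intro G _ _ _ _ hG
    letI : MeasurableSpace G := borel G
    haveI : BorelSpace G := ⟨rfl⟩
    intro r a ha h1 h3 h4
    exact latticeWard_of_latticeWardGermC_pointwise r a
      (stub_latticeWardGerm G hG r a ha h1 h3 ((uvHyperscalingC_pointwise_iff r a).2 h4))

end Summit.QuantumFields.YangMills.Cruxes.OSLegsAtWeakCouplingC.InheritedAmplitudeGates

end
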